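import Literature.AnabelianGeometry.SemiGraphs.ArithEdgeLikeTwoHosts
import HarnessLib

/-!
# [SemiAnbd] §5: the geometric part of the arithmetic branch decomposition group (proof-only)

Mochizuki, *Semi-graphs of Anabelioids*, Publ. RIMS **42** (2006) 221–322, §5 p. 65
[cite: MochizukiSemiAnbd2006, §5, p. 65]: "if `b` is a branch of an edge `e` of `𝔾` that abuts to `v`, then
we obtain a decomposition group `Π^temp_{𝔊,b} ⊆ Π^temp_{𝔊,v} ⊆ Π^temp_𝔊` [well-defined up to conjugation in
`Π^temp_𝔊`], which [since `𝔊` is totally estranged, hence, in particular totally aloof] may be thought of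
as the commensurator in `Π^temp_{𝔊,v}` of `Π^temp_{𝔾,b} := Π^temp_{𝔊,b} ∩ Π^temp_𝔾`."

PROOF-ONLY companion (abc-iut cell, L3 sub-DAG #4 `plan/L3/SUBDAG-SemiAnbd-Thm54.md`; T54 interface menu
items (H-DEF)_b / `hcomm_b` at LEVEL A — finding F-d040-1; row T54-4e, seat abc-iut-w4-d040) over
abc-iut-w4-d053's produced data (`ArithDecompositionData.lean`: `Π^temp_{𝔊,b} := Π^temp_{𝔊,v} ∩ C(ι Π^temp_{𝔾,b})`).
No definition, no new named fact.

* GEOMETRIC CORE (the bracket "[since … totally estranged]" of p. 65, kernel form):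
  `commensurator_branch_inf_host_eq` — inside a verticial host `ψ(Π_v)` of `π₁^temp(𝒢)`, the commensurator
  of a branch group `ψ(g₀ Π_b g₀⁻¹)` meets the host in the branch group itself: an element `ψ(y₀)` of the
  host commensurating it gives `Π_b ∩ h Π_b h⁻¹` of finite index in the INFINITE `Π_b`
  (`infinite_branchSubgroup`), hence nontrivial, so `h ∈ Π_b` by total estrangement (the clause
  `b′ = b, g ∉ Π_b` of `IsEstrangedEdge`).
* WITH THE HOSTS PINNED DOWN (Thm 3.7 (iii) "precisely two", the tree's named fact `CompactInVerticial`,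
  carried as a hypothesis exactly as abc-iut-L3-t11 / abc-iut-w4-d085 carry it):
  `commensurator_inf_eq_of_edgeLike_le_verticial` — for ANY verticial `H ⊇ L`, `L` edge-like of an edge of a
  graph: `C(L) ∩ H = L` (every such `H` is one of the two LEMMA-E hosts, in each of which `L` is a branch
  group).
* LEVEL A: `arithBrGp_inf_range_eq_map` (abc-iut-w4-d053's `arithBrGp_inf_range` with its inputs `hct`,
  `hrel` DISCHARGED) — `Π^temp_{𝔊,b} ∩ ι(π₁^temp(𝒢)) = ι(Π^temp_{𝔾,b})` for the produced data, and the
  (H-DEF)_b input of T54-2 in `aug`-currency (`decompositionDataOfChart_brGp_inf_ker`); together with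
  `decompositionDataOfChart_vertGp_inf_ker` (vertex half, `ArithEdgeLikeTwoHosts.lean`) this discharges the
  (H-DEF) hypotheses of `intersectionWithGeometricStatement_of_chart_of_forall` at LEVEL A, leaving only
  (H-OUT) (the Def 5.1 (i)(c) action) to the producer.

Nothing here takes a side on [IUTchIII] Cor. 3.12; typed ≠ proved elsewhere.
-/

namespace Literature.AnabelianGeometry.SemiGraphs

namespace ProfiniteSemiGraph

open CategoryTheory Topology
open scoped Pointwise

universe u u'

variable {𝒢 : ProfiniteSemiGraph.{u}}

/-! ### The geometric core: the commensurator of a branch group inside its host -/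

/-- In `Π_v`: an element `h` commensurating the branch group `Π_b` lies in `Π_b` — `Π_b ∩ h Π_b h⁻¹` has
finite index in the infinite `Π_b`, so is nontrivial, which total estrangement forbids unless `h ∈ Π_b`.
[cite: MochizukiSemiAnbd2006, Def 2.4 (iv) / §5, pp. 26, 65] -/
theorem mem_branchSubgroup_of_commensurable (h𝒢 : 𝒢.Thm37Hypotheses) {b : 𝒢.graph.Branch}
    {v : 𝒢.graph.Vertex} (hb : 𝒢.graph.abuts b = some v) {h : 𝒢.Gv v}
    (hh : Subgroup.Commensurable (ConjAct.toConjAct h • 𝒢.branchSubgroup b v hb)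
      (𝒢.branchSubgroup b v hb)) : h ∈ 𝒢.branchSubgroup b v hb := by
  by_contra hnot
  have hest := (h𝒢.isTotallyEstranged (𝒢.graph.edgeOf b)).2 b rfl v hb b hb h (Or.inr hnot)
  -- `Π_b ∩ h Π_b h⁻¹ = ⊥`, so `h Π_b h⁻¹` has relative index `Nat.card Π_b = 0` in `Π_b`
  have hconj : ConjAct.toConjAct h • 𝒢.branchSubgroup b v hb =
      (𝒢.branchSubgroup b v hb).map (MulAut.conj h).toMonoidHom := rfl
  haveI := infinite_branchSubgroup h𝒢.toProp36Hypotheses hb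
  have h0 : (ConjAct.toConjAct h • 𝒢.branchSubgroup b v hb).relIndex (𝒢.branchSubgroup b v hb) = 0 := by
    rw [← Subgroup.inf_relIndex_left, hconj, hest, Subgroup.relIndex_bot_left]
    exact Nat.card_eq_zero_of_infinite
  exact hh.1 h0

/-- **The commensurator of a branch group meets its host in the branch group** (p. 65 "[since `𝔊` is
totally estranged …] the commensurator in `Π^temp_{𝔊,v}` of `Π^temp_{𝔾,b}`", geometric form): for an
INJECTIVE verticial homomorphism `ψ : Π_v → π₁^temp(𝒢)` and `g₀ ∈ Π_v`,
`C(ψ(g₀ Π_b g₀⁻¹)) ∩ ψ(Π_v) = ψ(g₀ Π_b g₀⁻¹)`. [cite: MochizukiSemiAnbd2006, §5, p. 65] -/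
theorem commensurator_branch_inf_host_eq (h𝒢 : 𝒢.Thm37Hypotheses) (c : TemperedPiChart 𝒢)
    {b : 𝒢.graph.Branch} {v : 𝒢.graph.Vertex} (hb : 𝒢.graph.abuts b = some v)
    (ψ : 𝒢.Gv v →ₜ* c.G) (hψ : Function.Injective ψ) (g₀ : 𝒢.Gv v) :
    Subgroup.Commensurable.commensurator
        (((𝒢.branchSubgroup b v hb).map (MulAut.conj g₀).toMonoidHom).map ψ.toMonoidHom) ⊓
          ψ.toMonoidHom.range =
      ((𝒢.branchSubgroup b v hb).map (MulAut.conj g₀).toMonoidHom).map ψ.toMonoidHom := by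
  set B := (𝒢.branchSubgroup b v hb).map (MulAut.conj g₀).toMonoidHom with hB
  -- reduce along the injective `ψ`: `C(ψ B) ∩ ψ(Π_v) = ψ(C(B))`
  rw [commensurator_map_inf_range hψ B]
  congr 1
  refine le_antisymm (fun y hy => ?_) (le_commensurator_self B)
  rw [Subgroup.Commensurable.commensurator_mem_iff] at hy
  -- conjugate back by `g₀⁻¹`: `h := g₀⁻¹ y g₀` commensurates `Π_b`
  have hy' := hy.conj (ConjAct.toConjAct g₀)⁻¹
  have hBsmul : B = ConjAct.toConjAct g₀ • 𝒢.branchSubgroup b v hb := rfl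
  rw [hBsmul, smul_smul, smul_smul, inv_smul_smul, ← map_inv, ← map_mul, ← map_mul] at hy'
  have hmem := mem_branchSubgroup_of_commensurable h𝒢 hb hy'
  -- so `y = g₀ h g₀⁻¹ ∈ g₀ Π_b g₀⁻¹`
  refine ⟨g₀⁻¹ * y * g₀, hmem, ?_⟩
  simp [MulAut.conj_apply, mul_assoc]

/-! ### With the hosts pinned down by Thm 3.7 (iii) -/

/-- **`C(L) ∩ H = L` for an edge-like `L` inside ANY verticial `H`** of `π₁^temp(𝒢)` (`𝒢` a graph of
anabelioids satisfying the hypotheses of Thm 3.7), modulo the named fact `CompactInVerticial` (Thm 3.7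
(iii) "precisely two", carried as by abc-iut-L3-t11): `H` is one of the two LEMMA-E hosts
`g φ_u(Π_u) g⁻¹`, `g′ φ_{u′}(Π_{u′}) g′⁻¹` of `L`, in each of which `L` is a branch group, and
`commensurator_branch_inf_host_eq` applies. [cite: MochizukiSemiAnbd2006, Thm 3.7 (iii) / §5, pp. 41, 65] -/
theorem commensurator_inf_eq_of_edgeLike_le_verticial (hCV : CompactInVerticial.{u})
    (h𝒢 : 𝒢.Thm37Hypotheses) (hG : 𝒢.graph.IsGraph) (c : TemperedPiChart 𝒢) {b : 𝒢.graph.Branch}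
    {w : 𝒢.graph.Vertex} {L H : Subgroup c.G} (hL : L ∈ edgeLikeSubgroups c (𝒢.graph.edgeOf b))
    (hH : H ∈ verticialSubgroups c w) (hLH : L ≤ H) :
    Subgroup.Commensurable.commensurator L ⊓ H = L := by
  classical
  have hVD := verticialDistinct_holds.{u}
  have hVI := verticialInjective_holds.{u}
  haveI := TemperedPiChart.t2Space c
  have hΦ' : ∀ v : 𝒢.graph.Vertex, ∃ φ : 𝒢.Gv v →ₜ* c.G, IsVerticialHom c v φ := by
    intro v
    obtain ⟨K, φ, hφ, -⟩ := (hVI 𝒢 h𝒢 c v).1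
    exact ⟨φ, hφ⟩
  choose Φ hΦ using hΦ'
  -- the two branches of the edge of `b`, their vertices, and the two presentations of `L`
  obtain ⟨b₁, b₂, h12, h1e, h2e, hall⟩ := 𝒢.graph.two_branches (𝒢.graph.edgeOf b)
  obtain ⟨u₁, hb₁⟩ := Option.isSome_iff_exists.mp (hG.abuts_isSome b₁)
  obtain ⟨u₂, hb₂⟩ := Option.isSome_iff_exists.mp (hG.abuts_isSome b₂)
  have hL₁ : L ∈ edgeLikeSubgroups c (𝒢.graph.edgeOf b₁) := by rw [h1e]; exact hL
  have hL₂ : L ∈ edgeLikeSubgroups c (𝒢.graph.edgeOf b₂) := by rw [h2e]; exact hL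
  obtain ⟨g₁, hLeq₁⟩ := edgeLike_eq_map_branchSubgroup c hb₁ hL₁ (Φ u₁) (hΦ u₁)
  obtain ⟨g₂, hLeq₂⟩ := edgeLike_eq_map_branchSubgroup c hb₂ hL₂ (Φ u₂) (hΦ u₂)
  set K₁ := (Φ u₁).toMonoidHom.range.map (MulAut.conj g₁).toMonoidHom with hK₁
  set K₂ := (Φ u₂).toMonoidHom.range.map (MulAut.conj g₂).toMonoidHom with hK₂
  have hK₁m : K₁ ∈ verticialSubgroups c u₁ :=
    conj_mem_verticialSubgroups c (range_mem_verticialSubgroups c (Φ u₁) (hΦ u₁)) g₁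
  have hK₂m : K₂ ∈ verticialSubgroups c u₂ :=
    conj_mem_verticialSubgroups c (range_mem_verticialSubgroups c (Φ u₂) (hΦ u₂)) g₂
  have hLK₁ : L ≤ K₁ := by rw [hLeq₁]; exact Subgroup.map_mono (Subgroup.map_le_range _ _)
  have hLK₂ : L ≤ K₂ := by rw [hLeq₂]; exact Subgroup.map_mono (Subgroup.map_le_range _ _)
  haveI := infinite_of_mem_edgeLikeSubgroups hVI h𝒢 c hL
  have hLne : L ≠ ⊥ := fun h => by
    rw [h] at this
    exact not_finite (⊥ : Subgroup c.G)
  have hKK : K₁ ≠ K₂ := by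
    intro hKK
    refine h12 (branch_eq_of_hosts_eq hVD hVI h𝒢 c Φ hΦ hLne hb₁ hb₂ g₁ g₂ ?_ ?_ hKK)
    · rw [← hLeq₁]
    · rw [← hLeq₂]
  -- by Thm 3.7 (iii) ("precisely two") the host `H` is `K₁` or `K₂`
  have hLc : IsCompact (L : Set c.G) := isCompact_of_mem_edgeLikeSubgroups c hL
  obtain ⟨honly, -⟩ := (hCV 𝒢 h𝒢 c L hLc).2 hLne u₁ u₂ K₁ K₂ hK₁m hK₂m hKK hLK₁ hLK₂
  -- the host presentation `g φ_u` as ONE injective continuous homomorphism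
  have key : ∀ {u : 𝒢.graph.Vertex} {b' : 𝒢.graph.Branch} (hb' : 𝒢.graph.abuts b' = some u) (g : c.G),
      L = ((𝒢.branchSubgroup b' u hb').map (Φ u).toMonoidHom).map (MulAut.conj g).toMonoidHom →
      H = (Φ u).toMonoidHom.range.map (MulAut.conj g).toMonoidHom →
      Subgroup.Commensurable.commensurator L ⊓ H = L := by
    intro u b' hb' g hLe hHe
    let ψ : 𝒢.Gv u →ₜ* c.G :=
      { toMonoidHom := (MulAut.conj g).toMonoidHom.comp (Φ u).toMonoidHom
        continuous_toFun := by
          exact ((continuous_const.mul continuous_id).mul continuous_const).comp (Φ u).continuous }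
    have hψinj : Function.Injective ψ :=
      (MulAut.conj g).injective.comp ((hVI 𝒢 h𝒢 c u).2 (Φ u) (hΦ u))
    have hrange : ψ.toMonoidHom.range = H := by
      rw [hHe, MonoidHom.range_eq_map, MonoidHom.range_eq_map, Subgroup.map_map]
    have hLψ : ((𝒢.branchSubgroup b' u hb').map (MulAut.conj (1 : 𝒢.Gv u)).toMonoidHom).map
        ψ.toMonoidHom = L := by
      have h1 : (𝒢.branchSubgroup b' u hb').map (MulAut.conj (1 : 𝒢.Gv u)).toMonoidHom =
          𝒢.branchSubgroup b' u hb' := by ext x; simp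
      rw [h1, hLe, Subgroup.map_map]
    have h := commensurator_branch_inf_host_eq h𝒢 c hb' ψ hψinj 1
    rw [hLψ, hrange] at h
    exact h
  rcases honly w H hH hLH with rfl | rfl
  · exact key hb₁ g₁ hLeq₁ rfl
  · exact key hb₂ g₂ hLeq₂ rfl

/-! ### LEVEL A: the geometric part of the produced branch group -/

variable {c : TemperedPiChart 𝒢} {Gtp : Type u'} [Group Gtp]

/-- **`Π^temp_{𝔊,b} ∩ Π^temp_𝔾 = Π^temp_{𝔾,b}`** for the PRODUCED data (p. 65): with
`Π^temp_{𝔊,b} := Π^temp_{𝔊,v} ∩ C(ι Π^temp_{𝔾,b})`, intersecting with `ι(π₁^temp(𝒢))` gives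
`ι(Π_v-representative ∩ C(Π_b-representative)) = ι(Π_b-representative)` by
`commensurator_inf_eq_of_edgeLike_le_verticial` — modulo `CompactInVerticial` (Thm 3.7 (iii)); this is
abc-iut-w4-d053's `arithBrGp_inf_range` with its geometric inputs `hct`, `hrel` DISCHARGED.
[cite: MochizukiSemiAnbd2006, §5, p. 65] -/
theorem arithBrGp_inf_range_eq_map (hCV : CompactInVerticial.{u}) (h𝒢 : 𝒢.Thm37Hypotheses)
    (hG : 𝒢.graph.IsGraph) (R : ChartRepresentatives c) (ι : c.G →* Gtp) (hι : Function.Injective ι)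
    (b : 𝒢.graph.Branch) : arithBrGp R ι b ⊓ ι.range = (R.Hb b).map ι := by
  obtain ⟨v, hbv⟩ := Option.isSome_iff_exists.mp (hG.abuts_isSome b)
  rw [arithBrGp_inf_range R hι hbv (commensurator_eq_of_mem_verticialSubgroups h𝒢 c (R.Hv_mem v)),
    inf_comm, commensurator_inf_eq_of_edgeLike_le_verticial hCV h𝒢 hG c (R.Hb_mem b) (R.Hv_mem v)
      (R.Hb_le b v hbv)]

/-- The branch half of the T54-2 input (H-DEF) in `aug`-currency, at LEVEL A (modulo `CompactInVerticial`):
"`brGp b ∩ Ker aug` is the image of an edge-like subgroup of the edge of `b`" for the produced data.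
[cite: MochizukiSemiAnbd2006, §5, p. 65] -/
theorem decompositionDataOfChart_brGp_inf_ker (hCV : CompactInVerticial.{u}) (h𝒢 : 𝒢.Thm37Hypotheses)
    (hG : 𝒢.graph.IsGraph) (R : ChartRepresentatives c) (ι : c.G →* Gtp) (hι : Function.Injective ι)
    {PA : Type*} [Group PA] (aug : Gtp →* PA) (hexact : ι.range = aug.ker) (b : 𝒢.graph.Branch) :
    ∃ e : 𝒢.graph.Edge, ∃ L ∈ edgeLikeSubgroups c e,
      (decompositionDataOfChart R ι).brGp b ⊓ aug.ker = L.map ι := by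
  refine ⟨𝒢.graph.edgeOf b, R.Hb b, R.Hb_mem b, ?_⟩
  rw [decompositionDataOfChart_brGp, ← hexact, arithBrGp_inf_range_eq_map hCV h𝒢 hG R ι hι b]

/-- **(H-DEF) at LEVEL A, both halves** — the two definitional inputs of
`intersectionWithGeometricStatement_of_chart_of_forall` (`ArithIntersectionWithGeometricProofs`) hold for
the produced data (vertex half unconditionally, branch half modulo `CompactInVerticial`); with them the
second sentence of Rmk 5.3.1 for the produced data reduces to (H-OUT) alone (the Def 5.1 (i)(c) action,
producer LEVEL B). [cite: MochizukiSemiAnbd2006, Rmk 5.3.1, p. 65] -/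
theorem intersectionWithGeometricStatement_ofChart (hCV : CompactInVerticial.{u})
    (h𝒢 : 𝒢.Thm37Hypotheses) (hG : 𝒢.graph.IsGraph) (R : ChartRepresentatives c) (ι : c.G →* Gtp)
    (hι : Function.Injective ι) {PA : Type*} [Group PA] (aug : Gtp →* PA) (hexact : ι.range = aug.ker)
    (hVout : ∀ (g : Gtp) (K : Subgroup Gtp),
      (∃ w : 𝒢.graph.Vertex, ∃ H ∈ verticialSubgroups c w, K = H.map ι) →
        ∃ w : 𝒢.graph.Vertex, ∃ H ∈ verticialSubgroups c w, conjSubgroup g K = H.map ι)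
    (hBout : ∀ (g : Gtp) (K : Subgroup Gtp),
      (∃ e : 𝒢.graph.Edge, ∃ L ∈ edgeLikeSubgroups c e, K = L.map ι) →
        ∃ e : 𝒢.graph.Edge, ∃ L ∈ edgeLikeSubgroups c e, conjSubgroup g K = L.map ι) :
    IntersectionWithGeometricStatement (decompositionDataOfChart R ι) aug
      (fun K => ∃ w : 𝒢.graph.Vertex, ∃ H ∈ verticialSubgroups c w, K = H.map ι)
      (fun K => ∃ e : 𝒢.graph.Edge, ∃ L ∈ edgeLikeSubgroups c e, K = L.map ι) :=
  intersectionWithGeometricStatement_of_chart_of_forall c (decompositionDataOfChart R ι) ι aug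
    (fun v => (decompositionDataOfChart_vertGp_inf_ker h𝒢 R ι hι aug hexact v).1) hVout
    (fun b => decompositionDataOfChart_brGp_inf_ker hCV h𝒢 hG R ι hι aug hexact b) hBout

end ProfiniteSemiGraph

end Literature.AnabelianGeometry.SemiGraphs
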